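import Summits.AtomisticToContinuum.Crystallization.Theorems.OverbindingBudgetEnergyPinningFloor

/-!
# OverbindingBudget · decomp-a2c lens-4 g34 — part XXII-E: the energy cut at the SHARP level `e⋆ + κ′` (no energy literal)

Helper file under `--supports stmt-AtomisticToContinuum-31280` (RDEF = `Theses.OverbindingBudget.RobustDefectLimitWindows`); closes nothing.

With E1 a theorem (part XXII-C) the only `e₁` the energy cut of ★ `StackedCellPinningU` needs is one with `limsup_N E(N)/N ≤ e₁`; the sharpest
such value is the tree's `e⋆ := ⨅_Q e(Q)` (`ChargedEnergyGapNegative.eStar`), for which the trial bound is the one-liner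
`le_ciInf ChargedEnergyGapNegative.limsup_div_le_energyPerParticle` (= item 11865 `CrysEnergyUpper`, PROVED in the tree).  Hence:
* `energyTrialBound_eStar : EnergyTrialBound e⋆` [PROVED];
* the cell-energy leaves are ANTITONE in their level (`strainedCellEnergyT_anti`, `strainedCellEnergyS_anti`), so a certifier proves
  E2T/E2S at ANY numeric level `u + κ′` with `u` a certified periodic trial energy of ITS OWN choosing (`strainedCellEnergyT_eStar_of_periodic`:
  `e(Q) ≤ u → StrainedCellEnergyT Λ₁ s₁ s₂ (u + κ′) → StrainedCellEnergyT Λ₁ s₁ s₂ (e⋆ + κ′)`, via `eStar_le Q`) — the sharpening of the energy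
  level (`−0.7175 → e(hcp) ≈ −0.71759`) is thereby moved INTO the E2 certificate, where the interval lattice sums live anyway, and no certificate
  module of the tree is load-bearing for the cone;
* ★ `stackedCellPinningU_of_cellEnergy_eStar : 0 < κ′ → Λ₁ ≤ 17/16 → StrainedCellEnergyT Λ₁ s₁ s₂ (e⋆ + κ′) → StrainedCellEnergyS Λ₁ t₁ t₂ (e⋆ + κ′) →
  StackedCellPinningU Λ₁ s₁ s₂ t₁ t₂` [PROVED];
* cones XXVI `rdef_twentysixth_of_recordK_energy_eStar[_ref]` [PROVED]: beneath 7d the open energy leaves are exactly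
  E2T `StrainedCellEnergyT (17/16) s₁ s₂ (e⋆ + κ′)` and E2S `StrainedCellEnergyS (17/16) t₁ t₂ (e⋆ + κ′)` [CERT·M], `κ′ > 0` the certifier's.
Also recorded: the two-sided pinch `N·e⋆ ≤ E(N)` (`ChargedEnergyGapNegative.eStar_le_groundStateEnergy_div`, tree) is not needed here.
-/

noncomputable section

namespace Summit.AtomisticToContinuum.Crystallization.Theorems.OverbindingBudgetEnergyPinningStar

open Literature.MathematicalPhysics.StatisticalMechanics (lennardJones groundStateEnergy PeriodicConfiguration)
open Summit.AtomisticToContinuum.Crystallization.Theses.OverbindingBudget (RobustDefectLimitWindows)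
open Summit.AtomisticToContinuum.Crystallization.Theses.PricedLinkCensus (ChargedEnergyGap)
open Summit.AtomisticToContinuum.Crystallization.Theorems.ChargedEnergyGapNegative (eStar eStar_le limsup_div_le_energyPerParticle)
open Summit.AtomisticToContinuum.Crystallization.Theorems.OverbindingBudgetGradedBareness (CleanlessExcessT)
open Summit.AtomisticToContinuum.Crystallization.Theorems.OverbindingBudgetCoherentCut (CoherentResidual)
open Summit.AtomisticToContinuum.Crystallization.Theorems.OverbindingBudgetUniformCutStatements (GrossCleanBallsU)
open Summit.AtomisticToContinuum.Crystallization.Theorems.OverbindingBudgetElasticSplitScale (CompressedVirialLaw)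
open Summit.AtomisticToContinuum.Crystallization.Theorems.ChartedPlanarOrderChunkFloor (E3)
open Summit.AtomisticToContinuum.Crystallization.Theorems.ChartedPlanarOrderTubeConvex (TubeConvexW' TubeConvexRef)
open Summit.AtomisticToContinuum.Crystallization.Theorems.OverbindingBudgetScaleWidening (DoorPeriodicW)
open Summit.AtomisticToContinuum.Crystallization.Theorems.OverbindingBudgetTwoShellShape (TwoShellShape BarlowGluingW)
open Summit.AtomisticToContinuum.Crystallization.Theorems.OverbindingBudgetStackedRigidityW (StackedReductionW GapStressVanishesW)
open Summit.AtomisticToContinuum.Crystallization.Theorems.OverbindingBudgetStackedRigidityRef (RegistryPinningW)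
open Summit.AtomisticToContinuum.Crystallization.Theorems.OverbindingBudgetRegistryCut (RegistryResidual RegistryTube RegistryMetric)
open Summit.AtomisticToContinuum.Crystallization.Theorems.OverbindingBudgetRegistryDichotomy (RegistryGeometryW BalancedLocus
  SqRegistryGeometryW SqBalancedHeight SqRegistryMetric)
open Summit.AtomisticToContinuum.Crystallization.Theorems.OverbindingBudgetRegistryDichotomyCW (RegistryMetricCW SqRegistryMetricCW)
open Summit.AtomisticToContinuum.Crystallization.Theorems.OverbindingBudgetEnergyPinning (StackedCellPinningU)
open Summit.AtomisticToContinuum.Crystallization.Theorems.OverbindingBudgetEnergyPinningCut (EnergyTrialBound energyTrialBound_of_limsup_le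
  MeanSiteEnergyFloor StrainedCellEnergyT StrainedCellEnergyS)
open Summit.AtomisticToContinuum.Crystallization.Theorems.OverbindingBudgetEnergyPinningFloor (stackedCellPinningU_of_cellEnergy
  rdef_twentyfourth_of_recordK_energy rdef_twentyfourth_of_recordK_energy_ref)

/-! ## §1 The trial bound at `e⋆` -/

/-- **`limsup_N E(N)/N ≤ e⋆`** (= item 11865 `CrysEnergyUpper`; `le_ciInf` of `ChargedEnergyGapNegative.limsup_div_le_energyPerParticle`). [tree] -/
theorem limsup_groundStateEnergy_div_le_eStar :
    Filter.limsup (fun N : ℕ => groundStateEnergy lennardJones 3 N / N) Filter.atTop ≤ eStar :=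
  le_ciInf limsup_div_le_energyPerParticle

/-- ★ **`EnergyTrialBound e⋆`** — the known energy leaf at its sharp level. [this file] -/
theorem energyTrialBound_eStar : EnergyTrialBound eStar :=
  energyTrialBound_of_limsup_le limsup_groundStateEnergy_div_le_eStar

/-- `EnergyTrialBound` is monotone in the level. [this file] -/
theorem energyTrialBound_mono {e e' : ℝ} (h : EnergyTrialBound e) (he : e ≤ e') : EnergyTrialBound e' := by
  intro ε hε
  filter_upwards [h ε hε] with N hN
  have hN0 : (0 : ℝ) ≤ N := Nat.cast_nonneg N
  nlinarith

/-! ## §2 The cell-energy leaves are antitone in their level -/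

/-- `MeanSiteEnergyFloor` is antitone in the level. [this file] -/
theorem meanSiteEnergyFloor_anti {e e' : ℝ} {Y : Set E3} (h : MeanSiteEnergyFloor e Y) (he : e' ≤ e) : MeanSiteEnergyFloor e' Y := by
  obtain ⟨ℓ₁, hℓ₁⟩ := h
  refine ⟨ℓ₁, fun ℓ hℓ c F hF => ?_⟩
  have h1 := hℓ₁ ℓ hℓ c F hF
  have hF0 : (0 : ℝ) ≤ F.card := Nat.cast_nonneg _
  nlinarith

/-- E2T is antitone in its level. [this file] -/
theorem strainedCellEnergyT_anti {Λ₁ s₁ s₂ e e' : ℝ} (h : StrainedCellEnergyT Λ₁ s₁ s₂ e) (he : e' ≤ e) : StrainedCellEnergyT Λ₁ s₁ s₂ e' :=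
  fun δ hδ a b w hst hab ha hb hsep hc hN hsf hg hT hnp => meanSiteEnergyFloor_anti (h δ hδ a b w hst hab ha hb hsep hc hN hsf hg hT hnp) he

/-- E2S is antitone in its level. [this file] -/
theorem strainedCellEnergyS_anti {Λ₁ t₁ t₂ e e' : ℝ} (h : StrainedCellEnergyS Λ₁ t₁ t₂ e) (he : e' ≤ e) : StrainedCellEnergyS Λ₁ t₁ t₂ e' :=
  fun δ hδ a b w hst hab ha hb hsep hc hN hsf hg hS hnp => meanSiteEnergyFloor_anti (h δ hδ a b w hst hab ha hb hsep hc hN hsf hg hS hnp) he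

/-- **The certifier's entry point, T branch:** E2T at a numeric level `u + κ′`, `u` ANY certified periodic trial energy (`e(Q) ≤ u`), gives E2T at
the sharp level `e⋆ + κ′` (`eStar_le Q`). [this file] -/
theorem strainedCellEnergyT_eStar_of_periodic {Λ₁ s₁ s₂ u κ' : ℝ} (Q : PeriodicConfiguration 3) (hQ : Q.energyPerParticle lennardJones ≤ u)
    (h : StrainedCellEnergyT Λ₁ s₁ s₂ (u + κ')) : StrainedCellEnergyT Λ₁ s₁ s₂ (eStar + κ') :=
  strainedCellEnergyT_anti h (by linarith [eStar_le Q])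

/-- **The certifier's entry point, S branch.** [this file] -/
theorem strainedCellEnergyS_eStar_of_periodic {Λ₁ t₁ t₂ u κ' : ℝ} (Q : PeriodicConfiguration 3) (hQ : Q.energyPerParticle lennardJones ≤ u)
    (h : StrainedCellEnergyS Λ₁ t₁ t₂ (u + κ')) : StrainedCellEnergyS Λ₁ t₁ t₂ (eStar + κ') :=
  strainedCellEnergyS_anti h (by linarith [eStar_le Q])

/-! ## §3 The energy cut and the cones at the sharp level -/

/-- ★ **the energy cut at the sharp level:** `StrainedCellEnergyT Λ₁ s₁ s₂ (e⋆ + κ′) → StrainedCellEnergyS Λ₁ t₁ t₂ (e⋆ + κ′) → StackedCellPinningU Λ₁ s₁ s₂ t₁ t₂`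
(`0 < κ′`, `Λ₁ ≤ 17/16`). [this file] -/
theorem stackedCellPinningU_of_cellEnergy_eStar {Λ₁ s₁ s₂ t₁ t₂ κ' : ℝ} (hκ' : 0 < κ') (hΛ₁ : Λ₁ ≤ 17 / 16)
    (hT : StrainedCellEnergyT Λ₁ s₁ s₂ (eStar + κ')) (hS : StrainedCellEnergyS Λ₁ t₁ t₂ (eStar + κ')) : StackedCellPinningU Λ₁ s₁ s₂ t₁ t₂ :=
  stackedCellPinningU_of_cellEnergy hκ' hΛ₁ energyTrialBound_eStar hT hS

/-- ★ **RDEF cone, TWENTY-SIXTH form at the numbers of record: ENERGY PINNING at the sharp level `e⋆ + κ′`** (W′ currency): beneath 7d the open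
energy leaves are exactly E2T `StrainedCellEnergyT (17/16) s₁ s₂ (e⋆ + κ′)` and E2S `StrainedCellEnergyS (17/16) t₁ t₂ (e⋆ + κ′)` [CERT·M] — no energy
literal, no certificate module of the tree in the cone. [this file] -/
theorem rdef_twentysixth_of_recordK_energy_eStar (s₁ s₂ t₁ t₂ h₀ h₁ κ' : ℝ) (hκ' : 0 < κ') (hG : GrossCleanBallsU (1 / 250) 10)
    (hCEG : ChargedEnergyGap) (hC : CompressedVirialLaw (1 / 250) 10) (hS : TwoShellShape (1 / 100) (3 / 50) (1 / 450)) (hB₂ : BarlowGluingW)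
    (hD : DoorPeriodicW 2) (hSR : StackedReductionW 2 (17 / 16)) (hV : GapStressVanishesW (17 / 16))
    (hP : RegistryPinningW (17 / 16) (1 / 40) (3 / 16)) (hT : TubeConvexW' (17 / 16) (1 / 40))
    (hET : StrainedCellEnergyT (17 / 16) s₁ s₂ (eStar + κ')) (hES : StrainedCellEnergyS (17 / 16) t₁ t₂ (eStar + κ'))
    (hGeo : RegistryGeometryW (17 / 16) s₁ s₂ h₀ (3 / 20)) (hBal : BalancedLocus s₁ s₂ h₀ (1 / 40)) (hR1 : RegistryResidual s₁ s₂ (1 / 250))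
    (hR2 : RegistryTube s₁ s₂ (1 / 100) 1) (hMet : RegistryMetric s₁ s₂ (3 / 500)) (hSqGeo : SqRegistryGeometryW (17 / 16) t₁ t₂ h₁ (3 / 20))
    (hSqH : SqBalancedHeight t₁ t₂ h₁ (1 / 100)) (hSqMet : SqRegistryMetric t₁ t₂ h₁ (1 / 100) 0) (hCE : CleanlessExcessT)
    (hRes : CoherentResidual 10) : RobustDefectLimitWindows :=
  rdef_twentyfourth_of_recordK_energy s₁ s₂ t₁ t₂ h₀ h₁ eStar κ' hκ' hG hCEG hC hS hB₂ hD hSR hV hP hT energyTrialBound_eStar hET hES hGeo hBal hR1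
    hR2 hMet hSqGeo hSqH hSqMet hCE hRes

/-- ★ **RDEF cone, twenty-sixth form at the numbers of record, reference-centred (CURRENCY OF RECORD): ENERGY PINNING at the sharp level `e⋆ + κ′`.**
[this file] -/
theorem rdef_twentysixth_of_recordK_energy_eStar_ref (s₁ s₂ t₁ t₂ h₀ h₁ κ' : ℝ) (hκ' : 0 < κ') (hG : GrossCleanBallsU (1 / 250) 10)
    (hCEG : ChargedEnergyGap) (hC : CompressedVirialLaw (1 / 250) 10) (hS : TwoShellShape (1 / 100) (3 / 50) (1 / 450)) (hB₂ : BarlowGluingW)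
    (hD : DoorPeriodicW 2) (hSR : StackedReductionW 2 (17 / 16)) (hV : GapStressVanishesW (17 / 16))
    (hP : RegistryPinningW (17 / 16) (1 / 40) (3 / 16)) (hT : TubeConvexRef (17 / 16) (1 / 40))
    (hET : StrainedCellEnergyT (17 / 16) s₁ s₂ (eStar + κ')) (hES : StrainedCellEnergyS (17 / 16) t₁ t₂ (eStar + κ'))
    (hGeo : RegistryGeometryW (17 / 16) s₁ s₂ h₀ (3 / 20)) (hBal : BalancedLocus s₁ s₂ h₀ (1 / 40)) (hR1 : RegistryResidual s₁ s₂ (1 / 250))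
    (hR2 : RegistryTube s₁ s₂ (1 / 100) 1) (hMet : RegistryMetricCW s₁ s₂ (3 / 500))
    (hSqGeo : SqRegistryGeometryW (17 / 16) t₁ t₂ h₁ (3 / 20)) (hSqH : SqBalancedHeight t₁ t₂ h₁ (1 / 100))
    (hSqMet : SqRegistryMetricCW t₁ t₂ h₁ (1 / 100) 0) (hCE : CleanlessExcessT) (hRes : CoherentResidual 10) : RobustDefectLimitWindows :=
  rdef_twentyfourth_of_recordK_energy_ref s₁ s₂ t₁ t₂ h₀ h₁ eStar κ' hκ' hG hCEG hC hS hB₂ hD hSR hV hP hT energyTrialBound_eStar hET hES hGeo hBal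
    hR1 hR2 hMet hSqGeo hSqH hSqMet hCE hRes

end Summit.AtomisticToContinuum.Crystallization.Theorems.OverbindingBudgetEnergyPinningStar

end
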